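import Literature.AlgebraicGeometry.Motives.CyclesGraphClosure
import Literature.AlgebraicGeometry.Motives.CyclesPushforwardSymmetry
import Literature.AlgebraicGeometry.Motives.CyclesPrincipalDivisorProofs
import HarnessLib

/-!
# `p_* div(f) = 0` in relative dimension one (Fulton, Prop. 1.4 (a); Stacks 02S2)

The discharge, up to the existence of the projective line package of
`Motives/ProjectiveLineInvolution` (taken here as the hypothesis `hpkg` so that this file does not
depend on that definition file), of the named fact
`Literature.AlgebraicGeometry.Motives.map_div_eq_zero_of_dim_eq_add_one`: for `p : X → Y` proper
dominant of integral schemes locally of finite type over a field `k` with `dim X = dim Y + 1` and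
`f ∈ R(X)^*`, `p_* div(f) = 0`.

Proof (Fulton, *Intersection Theory*, Prop. 1.4 (a), p. 13, reorganised over the base `Y`; Fulton
passes to the generic fibre, normalises and maps to `ℙ¹_{R(Y)}`):
* if `f` is algebraic over `R(Y)`, every `ord_x(f)`, `x` over the generic point of `Y`, vanishes
  (`Literature.AlgebraicGeometry.Motives.map_ord_eq_zero_of_isAlgebraic`,
  `Motives/CyclesPushforwardRelDimOne`);
* if `f` is transcendental over `R(Y)`: let `X' → X ×_k ℙ¹` be the closure of the graph of `f`
  (`Literature.AlgebraicGeometry.Motives.exists_graphClosure`), `π : X' → X` (proper, birational),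
  `ψ₀ = (π p, f) : X' → P_Y = Y ×_k ℙ¹`, `q : P_Y → Y`.  Then
  `p_* div(f) = p_* π_* div(π^♯ f)` (Stacks 02RT for the birational `π`,
  `Literature.AlgebraicGeometry.Motives.map_div_eq_div_norm_holds`, the norm along an isomorphism
  being the identity) `= q_* ψ₀_* div(π^♯ f)` (Stacks 02R5) `= q_* div(Nm π^♯ f) = q_* div(t^d)`
  (Stacks 02RT for `ψ₀`, which is dominant because its image `Z ⊆ P_Y` has function field of
  transcendence degree `1` over `R(Y)` — it contains `t ↦ π^♯ f` — hence `dim Z = n + 1 = dim P_Y`,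
  `Literature.AlgebraicGeometry.Motives.height_top_eq_height_top_add_trdeg`)
  `= d · q_* div(t) = 0` by the symmetry `t ↦ t⁻¹` of `ℙ¹`
  (`Literature.AlgebraicGeometry.Motives.map_ord_eq_zero_of_involution`).

Everything here is proved.

## References

* [Fulton1998] W. Fulton, *Intersection Theory*, 2nd ed. (1998), Prop. 1.4 (a) and its proof.
* [StacksProject] The Stacks Project, Chow Homology, Lemma 42.20.3 (Tag 02S2), Lemma 42.18.1
  (Tag 02RT), Lemma 42.12.2 (Tag 02R5).
-/

open CategoryTheory AlgebraicGeometry Order Topology TopologicalSpace Limits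

universe u

noncomputable section

namespace Literature.AlgebraicGeometry.Motives

/-- **Fulton, Prop. 1.4 (a) / Stacks 02S2 (`dim Z' = dim Z + 1`)**: given a projective line
package as produced by `ProjLine.exists_projectiveLine` (a proper geometrically integral
`k`-scheme `P` with an involution `σ` over `k` inverting a rational function `t ≠ 0`, an affine
chart `Spec k[T] ↪ P`, and coordinate morphisms `U → P` from functions on affine integral
`k`-schemes), the named fact `map_div_eq_zero_of_dim_eq_add_one` holds: `p_* div(f) = 0` for
`p : X → Y` proper dominant of integral schemes locally of finite type over `k` with
`dim X = dim Y + 1`. See the module docstring for the proof.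
[cite: Fulton1998, Prop. 1.4 (a)] [cite: StacksProject, Tag 02S2] -/
theorem map_div_eq_zero_of_dim_eq_add_one_of_projectiveLine
    (hpkg : ∀ (k : Type u) [Field k],
      ∃ (P : Scheme.{u}) (toS : P ⟶ Spec (.of k)) (_ : IsIntegral P) (_ : IsProper toS)
        (_ : GeometricallyIntegral toS) (_ : Flat toS) (_ : UniversallyOpen toS) (σ : P ⟶ P)
        (_ : IsIso σ) (_ : IsDominant σ) (t : P.functionField) (j : Spec (.of (Polynomial k)) ⟶ P)
        (_ : IsOpenImmersion j),
        σ ≫ σ = 𝟙 P ∧ σ ≫ toS = toS ∧ t ≠ 0 ∧ RatFn.functionFieldMap σ t = t⁻¹ ∧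
        j ≫ toS = Spec.map (CommRingCat.ofHom (algebraMap k (Polynomial k))) ∧
        ∀ (U : Scheme.{u}) [IsIntegral U] [IsAffine U] (u : U ⟶ Spec (.of k)) (a : Γ(U, ⊤)),
          ∃ ρ : U ⟶ P, ρ ≫ toS = u ∧
            ((letI := (Segre.pull u).toAlgebra; Transcendental k a) → IsDominant ρ) ∧
            ∀ [IsDominant ρ],
              RatFn.functionFieldMap ρ t = U.presheaf.germ ⊤ (genericPoint U) trivial a) :
    map_div_eq_zero_of_dim_eq_add_one.{u} := by
  intro k _ X Y p _ _ _ _ _ _ _ _ n hX hY f hf c hc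
  classical
  letI algYX : Algebra Y.left.functionField X.left.functionField :=
    (RatFn.functionFieldMap p.left).toAlgebra
  -- the case `f` algebraic over `R(Y)`
  by_cases halg : IsAlgebraic Y.left.functionField f
  · exact map_ord_eq_zero_of_isAlgebraic p n hX hY f hf halg c hc
  -- `f` is transcendental over `R(Y)`, hence over `k`
  let ι := (Scheme.ΓSpecIso (.of k)).inv.hom
  letI algX : Algebra k X.left.functionField :=
    ((X.left.presheaf.germ ⊤ (genericPoint X.left) trivial).hom.comp
      (X.hom.appTop.hom.comp ι)).toAlgebra
  letI algY : Algebra k Y.left.functionField :=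
    ((Y.left.presheaf.germ ⊤ (genericPoint Y.left) trivial).hom.comp
      (Y.hom.appTop.hom.comp ι)).toAlgebra
  haveI : IsScalarTower k Y.left.functionField X.left.functionField :=
    IsScalarTower.of_algebraMap_eq fun x ↦
      (functionFieldMap_algebraMap_top Y.hom p.left X.hom (Over.w p) x).symm
  have htr : Transcendental k f := fun h ↦ halg (h.tower_top _)
  -- the projective line and the closure of the graph of `f`
  obtain ⟨P, toS, hPi, hPp, hPgi, hPfl, hPuo, σ, hσi, hσd, t, j, hjo, hσσ, hσS, ht0, hσt, hjS,
    huniv⟩ := hpkg k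
  obtain ⟨X', hX'i, π, hπp, hπd, ψ, hψd, hψS, hπbij, hψt⟩ :=
    exists_graphClosure X.hom f hf htr toS t huniv
  -- `P_Y = Y ×_k P`, `q : P_Y → Y`, the involution `σ_Y = 𝟙 × σ`, and `ψ₀ = (π p, ψ) : X' → P_Y`
  haveI : IsIntegral (pullback Y.hom toS) := inferInstance
  haveI : LocallyOfFiniteType (pullback.fst Y.hom toS ≫ Y.hom) := inferInstance
  haveI : IsLocallyNoetherian (pullback Y.hom toS) :=
    LocallyOfFiniteType.isLocallyNoetherian (pullback.fst Y.hom toS ≫ Y.hom)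
  haveI : LocallyOfFiniteType (π ≫ X.hom) := inferInstance
  haveI : IsLocallyNoetherian X' := LocallyOfFiniteType.isLocallyNoetherian (π ≫ X.hom)
  let σY : pullback Y.hom toS ⟶ pullback Y.hom toS :=
    pullback.map Y.hom toS Y.hom toS (𝟙 _) σ (𝟙 _) (by simp) (by rw [hσS, Category.comp_id])
  haveI : IsIso σY := inferInstance
  have hψ₀w : (π ≫ p.left) ≫ Y.hom = ψ ≫ toS := by rw [Category.assoc, Over.w p, hψS]
  let ψ₀ : X' ⟶ pullback Y.hom toS := pullback.lift (π ≫ p.left) ψ hψ₀w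
  have hψ₀fst : ψ₀ ≫ pullback.fst Y.hom toS = π ≫ p.left := pullback.lift_fst _ _ _
  have hψ₀snd : ψ₀ ≫ pullback.snd Y.hom toS = ψ := pullback.lift_snd _ _ _
  haveI : IsProper (ψ₀ ≫ pullback.fst Y.hom toS) := by rw [hψ₀fst]; infer_instance
  haveI : IsProper ψ₀ := IsProper.of_comp ψ₀ (pullback.fst Y.hom toS)
  -- the objects over `k`
  let X'ₒ : SchemeOver k := Over.mk (π ≫ X.hom)
  let πₒ : X'ₒ ⟶ X := Over.homMk π rfl
  let PYₒ : SchemeOver k := Over.mk (pullback.fst Y.hom toS ≫ Y.hom)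
  let qₒ : PYₒ ⟶ Y := Over.homMk (pullback.fst Y.hom toS) rfl
  let σYₒ : PYₒ ⟶ PYₒ := Over.homMk σY (by
    change σY ≫ pullback.fst Y.hom toS ≫ Y.hom = pullback.fst Y.hom toS ≫ Y.hom
    rw [pullback.lift_fst_assoc, Category.comp_id])
  let ψₒ : X'ₒ ⟶ PYₒ := Over.homMk ψ₀ (by
    change ψ₀ ≫ pullback.fst Y.hom toS ≫ Y.hom = π ≫ X.hom
    rw [← Category.assoc, hψ₀fst, Category.assoc, Over.w p])
  -- instances in the `Over` spelling
  haveI : IsIntegral PYₒ.left := ‹IsIntegral (pullback Y.hom toS)›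
  haveI : LocallyOfFiniteType PYₒ.hom := ‹LocallyOfFiniteType (pullback.fst Y.hom toS ≫ Y.hom)›
  haveI : IsLocallyNoetherian PYₒ.left := ‹IsLocallyNoetherian (pullback Y.hom toS)›
  haveI : IsProper qₒ.left := inferInstanceAs (IsProper (pullback.fst Y.hom toS))
  haveI : IsIso σYₒ.left := ‹IsIso σY›
  haveI : IsIntegral X'ₒ.left := hX'i
  haveI : LocallyOfFiniteType X'ₒ.hom := ‹LocallyOfFiniteType (π ≫ X.hom)›
  haveI : IsLocallyNoetherian X'ₒ.left := ‹IsLocallyNoetherian X'›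
  haveI : IsProper πₒ.left := hπp
  haveI : IsDominant πₒ.left := hπd
  haveI : IsProper ψₒ.left := ‹IsProper ψ₀›
  have hσq : σYₒ ≫ qₒ = qₒ := by
    ext : 1
    change σY ≫ pullback.fst Y.hom toS = pullback.fst Y.hom toS
    rw [pullback.lift_fst, Category.comp_id]
  have hσσY : σYₒ ≫ σYₒ = 𝟙 PYₒ := by
    ext : 1
    change σY ≫ σY = 𝟙 _
    apply pullback.hom_ext
    · rw [Category.assoc, pullback.lift_fst, pullback.lift_fst_assoc, Category.id_comp,
        Category.comp_id, Category.comp_id]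
    · rw [Category.assoc, pullback.lift_snd, pullback.lift_snd_assoc, Category.id_comp,
        Category.assoc, hσσ, Category.comp_id]
  -- the rational function `t_Y = pr₂^♯ t` on `P_Y`, inverted by `σ_Y`
  haveI : Surjective Y.hom := ⟨fun s ↦ ⟨genericPoint Y.left, Subsingleton.elim _ _⟩⟩
  haveI : IsDominant (pullback.snd Y.hom toS) := inferInstance
  have hcongr : ∀ {A B : Scheme.{u}} [IsIntegral A] [IsIntegral B] {g g' : A ⟶ B} [IsDominant g]
      [IsDominant g'], g = g' → RatFn.functionFieldMap g = RatFn.functionFieldMap g' := by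
    intro A B _ _ g g' _ _ h; subst h; rfl
  let tY : (pullback Y.hom toS).functionField := RatFn.functionFieldMap (pullback.snd Y.hom toS) t
  have htY0 : tY ≠ 0 := (map_ne_zero_iff _ (RingHom.injective _)).mpr ht0
  have hσtY : RatFn.functionFieldMap σY tY = tY⁻¹ := by
    change RatFn.functionFieldMap σY (RatFn.functionFieldMap (pullback.snd Y.hom toS) t) = _
    rw [← RingHom.comp_apply, ← RatFn.functionFieldMap_comp,
      hcongr (pullback.lift_snd _ _ _ : σY ≫ pullback.snd Y.hom toS = pullback.snd Y.hom toS ≫ σ),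
      RatFn.functionFieldMap_comp, RingHom.comp_apply, hσt, map_inv₀]
  have hPYdim : height (⊤ : ↥(pullback Y.hom toS)) = (n + 1 : ℕ) := by
    rw [Nat.cast_add, Nat.cast_one]; exact height_top_pullback_eq_add_one toS j hjS Y.hom n hY
  -- `q_* div(t_Y) = 0` by symmetry
  let cT : AlgebraicCycle (pullback Y.hom toS) ℤ :=
    { toFun := fun y ↦ Scheme.ord tY y
      supportWithinDomain' := Set.subset_univ _
      supportLocallyFiniteWithinDomain' := fun z _ ↦ locallyFiniteSupport_ord tY z }
  have hqT : AlgebraicCycle.map (pullback.fst Y.hom toS) height height cT = 0 :=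
    map_ord_eq_zero_of_involution qₒ σYₒ hσq hσσY (n + 1) hPYdim tY htY0 hσtY cT rfl
  -- the rational function `f' = π^♯ f` on `X'` and its divisor
  let f' : X'.functionField := RatFn.functionFieldMap π f
  have hf'0 : f' ≠ 0 := (map_ne_zero_iff _ (RingHom.injective _)).mpr hf
  let c' : AlgebraicCycle X' ℤ :=
    { toFun := fun x ↦ Scheme.ord f' x
      supportWithinDomain' := Set.subset_univ _
      supportLocallyFiniteWithinDomain' := fun z _ ↦ locallyFiniteSupport_ord f' z }
  -- `dim X' = dim X = n + 1` (birational invariance)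
  letI algX' : Algebra k X'.functionField :=
    ((X'.presheaf.germ ⊤ (genericPoint X') trivial).hom.comp
      ((π ≫ X.hom).appTop.hom.comp ι)).toAlgebra
  let eπ : X.left.functionField ≃ₐ[k] X'.functionField :=
    AlgEquiv.ofBijective
      { toRingHom := RatFn.functionFieldMap π
        commutes' := fun x ↦ functionFieldMap_algebraMap_top X.hom π (π ≫ X.hom) rfl x } hπbij
  have hX'dim : height (⊤ : X') = (n + 1 : ℕ) := by
    rw [height_top_eq_of_algEquiv X.hom (π ≫ X.hom) eπ, hX, Nat.cast_add, Nat.cast_one]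
  -- Stacks 02RT for the birational `π`: `π_* div(f') = div(Nm f') = div(f)`
  have hπc : AlgebraicCycle.map π height height c' = c := by
    have h := map_div_eq_div_norm_holds πₒ (n + 1) hX'dim
      (by rw [hX, Nat.cast_add, Nat.cast_one]) f' hf'0 c' rfl
    ext x
    refine (congrFun h x).trans ?_
    rw [hc]
    letI algππ : Algebra X.left.functionField X'.functionField :=
      (RatFn.functionFieldMap π).toAlgebra
    change Scheme.ord (RatFn.norm π (algebraMap X.left.functionField X'.functionField f)) x = _
    congr 1
    -- `Nm (π^♯ f) = f`: `π^♯` is an isomorphism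
    have hrank : Module.finrank X.left.functionField X'.functionField = 1 := by
      have e := (AlgEquiv.ofBijective (Algebra.ofId X.left.functionField X'.functionField)
        hπbij).toLinearEquiv
      rw [← e.finrank_eq, Module.finrank_self]
    rw [RatFn.norm_apply, Algebra.norm_algebraMap, hrank, pow_one]
  -- reduction: `p_* div(f) = p_* π_* div(f') = (π p)_* div(f') = q_* ψ₀_* div(f')`
  have hmapcongr : ∀ {A B : Scheme.{u}} {g g' : A ⟶ B} [QuasiCompact g] [QuasiCompact g']
      (d : AlgebraicCycle A ℤ), g = g' →
      AlgebraicCycle.map g height height d = AlgebraicCycle.map g' height height d := by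
    intro A B g g' _ _ d h; subst h; rfl
  have hred : AlgebraicCycle.map p.left height height c =
      AlgebraicCycle.map (pullback.fst Y.hom toS) height height
        (AlgebraicCycle.map ψ₀ height height c') := by
    rw [← hπc, ← algebraicCycleMap_comp π p.left π.isClosedMap p.left.isClosedMap c',
      hmapcongr c' hψ₀fst.symm,
      algebraicCycleMap_comp ψ₀ (pullback.fst Y.hom toS) ψ₀.isClosedMap
        (pullback.fst Y.hom toS).isClosedMap c']
  rw [hred]
  -- `ψ₀` is dominant: its image `Z` has dimension `n + 1 = dim P_Y`
  haveI : IsDominant ψ₀ := by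
    haveI : QuasiCompact ψ₀ := inferInstance
    haveI hZi : IsIntegral ψ₀.image := isIntegral_image_of_isIntegral ψ₀
    haveI : LocallyOfFiniteType (ψ₀.imageι ≫ pullback.fst Y.hom toS ≫ Y.hom) := inferInstance
    haveI : IsDominant (ψ₀.toImage ≫ ψ₀.imageι ≫ pullback.fst Y.hom toS) := by
      rw [Scheme.Hom.toImage_imageι_assoc, hψ₀fst]; infer_instance
    haveI hqZ : IsDominant (ψ₀.imageι ≫ pullback.fst Y.hom toS) :=
      IsDominant.of_comp ψ₀.toImage _
    haveI : IsDominant (ψ₀.toImage ≫ ψ₀.imageι ≫ pullback.snd Y.hom toS) := by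
      rw [Scheme.Hom.toImage_imageι_assoc, hψ₀snd]; infer_instance
    haveI hsZ : IsDominant (ψ₀.imageι ≫ pullback.snd Y.hom toS) :=
      IsDominant.of_comp ψ₀.toImage _
    letI aYZ : Algebra Y.left.functionField ψ₀.image.functionField :=
      (RatFn.functionFieldMap (ψ₀.imageι ≫ pullback.fst Y.hom toS)).toAlgebra
    -- dimensions through transcendence degrees
    have h2 := height_top_eq_height_top_add_trdeg Y.hom (ψ₀.imageι ≫ pullback.fst Y.hom toS)
      (ψ₀.imageι ≫ pullback.fst Y.hom toS ≫ Y.hom) (by simp only [Category.assoc])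
    have h3 := height_top_eq_height_top_add_trdeg (ψ₀.imageι ≫ pullback.fst Y.hom toS ≫ Y.hom)
      ψ₀.toImage (π ≫ X.hom) (by
        rw [Scheme.Hom.toImage_imageι_assoc, ← Category.assoc, hψ₀fst, Category.assoc, Over.w p])
    -- `R(Z)` is not algebraic over `R(Y)`: it contains `t_Z ↦ f'`, transcendental over `R(Y)`
    have hZtr : ¬ Algebra.IsAlgebraic Y.left.functionField ψ₀.image.functionField := by
      letI aYX' : Algebra Y.left.functionField X'.functionField :=
        (RatFn.functionFieldMap (π ≫ p.left)).toAlgebra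
      intro hZalg
      -- `ψ_Z^♯ : R(Z) → R(X')` and `π^♯ : R(X) → R(X')` over `R(Y)`
      let eZ : ψ₀.image.functionField →ₐ[Y.left.functionField] X'.functionField :=
        { toRingHom := RatFn.functionFieldMap ψ₀.toImage
          commutes' := fun y ↦ by
            change RatFn.functionFieldMap ψ₀.toImage
              (RatFn.functionFieldMap (ψ₀.imageι ≫ pullback.fst Y.hom toS) y) =
              RatFn.functionFieldMap (π ≫ p.left) y
            rw [← RingHom.comp_apply, ← RatFn.functionFieldMap_comp,
              hcongr (by rw [Scheme.Hom.toImage_imageι_assoc, hψ₀fst])] }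
      let eX : X.left.functionField →ₐ[Y.left.functionField] X'.functionField :=
        { toRingHom := RatFn.functionFieldMap π
          commutes' := fun y ↦ by
            change RatFn.functionFieldMap π (RatFn.functionFieldMap p.left y) =
              RatFn.functionFieldMap (π ≫ p.left) y
            rw [← RingHom.comp_apply, ← RatFn.functionFieldMap_comp] }
      have htZ : eZ (RatFn.functionFieldMap (ψ₀.imageι ≫ pullback.snd Y.hom toS) t) = eX f := by
        change RatFn.functionFieldMap ψ₀.toImage
          (RatFn.functionFieldMap (ψ₀.imageι ≫ pullback.snd Y.hom toS) t) =
            RatFn.functionFieldMap π f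
        rw [← RingHom.comp_apply, ← RatFn.functionFieldMap_comp,
          hcongr (by rw [Scheme.Hom.toImage_imageι_assoc, hψ₀snd]), hψt]
      have h1 : IsAlgebraic Y.left.functionField (eX f) := by
        rw [← htZ]; exact (hZalg.isAlgebraic _).algHom eZ
      exact halg ((isAlgebraic_algHom_iff eX (RingHom.injective _)).mp h1)
    -- hence `dim Z = n + 1`
    obtain ⟨h2f, h2e⟩ := h2
    obtain ⟨h3f, h3e⟩ := h3
    have ha : Cardinal.toNat (Algebra.trdeg Y.left.functionField ψ₀.image.functionField) ≠ 0 := by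
      rw [Ne, Cardinal.toNat_eq_zero, not_or, not_le]
      exact ⟨fun h0 ↦ hZtr (trdeg_eq_zero_iff.mp h0), h2f⟩
    rw [hY] at h2e
    have hZn : height (⊤ : ↥ψ₀.image) =
        ((n + Cardinal.toNat (Algebra.trdeg Y.left.functionField ψ₀.image.functionField) : ℕ) :
          ℕ∞) := by
      have : ((height (⊤ : ↥ψ₀.image) : ℕ∞) : WithBot ℕ∞) =
          (((n + Cardinal.toNat (Algebra.trdeg Y.left.functionField ψ₀.image.functionField) :
            ℕ) : ℕ∞) : WithBot ℕ∞) := by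
        rw [h2e]; push_cast; rfl
      exact_mod_cast this
    rw [hZn, hX'dim] at h3e
    have hab : n + 1 = n + Cardinal.toNat (Algebra.trdeg Y.left.functionField
        ψ₀.image.functionField) +
          Cardinal.toNat (letI := (RatFn.functionFieldMap ψ₀.toImage).toAlgebra
            Algebra.trdeg ψ₀.image.functionField X'.functionField) := by
      exact_mod_cast h3e
    have hZdim : height (⊤ : ↥ψ₀.image) = ((n + 1 : ℕ) : ℕ∞) := by
      rw [hZn]; congr 1; omega
    -- the generic point of `Z` maps to the generic point of `P_Y`
    have hgen : ψ₀.imageι.base (⊤ : ↥ψ₀.image) = (⊤ : ↥(pullback Y.hom toS)) := by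
      by_contra hne
      have hlt : height (ψ₀.imageι.base (⊤ : ↥ψ₀.image)) < height (⊤ : ↥(pullback Y.hom toS)) :=
        height_strictMono (lt_top_of_ne_top hne)
          (lt_of_le_of_lt (height_mono le_top) (hPYdim ▸ ENat.coe_lt_top _))
      rw [height_base_eq_of_isClosedImmersion' ψ₀.imageι, hZdim, hPYdim] at hlt
      exact lt_irrefl _ hlt
    -- hence `ψ₀ = (X' → Z) ≫ (Z ↪ P_Y)` has dense image
    refine ⟨?_⟩
    rw [denseRange_iff_closure_range]
    apply Set.eq_univ_of_univ_subset
    rw [← (genericPoint_spec (↥(pullback Y.hom toS)) :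
      closure {genericPoint (↥(pullback Y.hom toS))} = Set.univ)]
    refine closure_minimal ?_ isClosed_closure
    rw [Set.singleton_subset_iff]
    have hrange : Set.range ψ₀.base = ψ₀.imageι.base '' Set.range ψ₀.toImage.base := by
      rw [← Set.range_comp, ← TopCat.coe_comp, ← Scheme.Hom.comp_base, Scheme.Hom.toImage_imageι]
    rw [hrange]
    refine (image_closure_subset_closure_image ψ₀.imageι.continuous) ?_
    refine ⟨⊤, ?_, hgen⟩
    rw [ψ₀.toImage.denseRange.closure_range]
    trivial
  haveI : IsDominant ψₒ.left := ‹IsDominant ψ₀›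
  -- Stacks 02RT for `ψ₀`: `ψ₀_* div(f') = div(Nm f') = div(t_Y ^ d) = d • div(t_Y)`
  have hψ₀t : RatFn.functionFieldMap ψ₀ tY = f' := by
    change RatFn.functionFieldMap ψ₀ (RatFn.functionFieldMap (pullback.snd Y.hom toS) t) = _
    rw [← RingHom.comp_apply, ← RatFn.functionFieldMap_comp, hcongr hψ₀snd, hψt]
  letI algψ : Algebra (pullback Y.hom toS).functionField X'.functionField :=
    (RatFn.functionFieldMap ψ₀).toAlgebra
  have hord_pow : ∀ (m : ℕ) (y : ↥(pullback Y.hom toS)),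
      Scheme.ord (tY ^ m) y = m * Scheme.ord tY y := by
    intro m y
    induction m with
    | zero =>
      have h2 : Scheme.ord (1 * 1 : (pullback Y.hom toS).functionField) y =
          Scheme.ord (1 : (pullback Y.hom toS).functionField) y +
            Scheme.ord (1 : (pullback Y.hom toS).functionField) y :=
        Scheme.ord_mul one_ne_zero one_ne_zero
      rw [mul_one] at h2
      simp only [pow_zero, Nat.cast_zero, zero_mul]
      omega
    | succ m ih =>
      rw [pow_succ, Scheme.ord_mul (pow_ne_zero _ htY0) htY0, ih]
      push_cast
      ring
  have hψc : AlgebraicCycle.map ψ₀ height height c' =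
      Module.finrank (pullback Y.hom toS).functionField X'.functionField • cT := by
    have h := map_div_eq_div_norm_holds ψₒ (n + 1) hX'dim hPYdim f' hf'0 c' rfl
    ext y
    refine (congrFun h y).trans ?_
    rw [Function.locallyFinsuppWithin.coe_nsmul, Pi.smul_apply]
    change Scheme.ord (RatFn.norm ψ₀ f') y = _ • Scheme.ord tY y
    rw [← hψ₀t, RatFn.norm_apply]
    change Scheme.ord (Algebra.norm _ (algebraMap _ X'.functionField tY)) y = _
    rw [Algebra.norm_algebraMap, hord_pow, nsmul_eq_mul]
  rw [hψc]
  -- `q_* (d • div t_Y) = d • q_* div(t_Y) = 0`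
  have hnsmul : ∀ m : ℕ, AlgebraicCycle.map (pullback.fst Y.hom toS) height height (m • cT) =
      m • AlgebraicCycle.map (pullback.fst Y.hom toS) height height cT := by
    intro m
    induction m with
    | zero => simp [algebraicCycleMap_zero]
    | succ m ih => rw [succ_nsmul, algebraicCycleMap_add, ih, succ_nsmul]
  rw [hnsmul, hqT, smul_zero]

end Literature.AlgebraicGeometry.Motives

end
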